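import Mathlib
import Summits.CriticalPhenomena.PercolationContinuityZ3.Theorems.PercNearOneGluingNoHeavyLowerTailPocketDepthGluing
import HarnessLib

/-!
# Crux `PercNearOneGluing.NoHeavyLowerTail` (stmt-CriticalPhenomena-4575), line `bhk-superadditivity-thinning` —
# POCKET-DEPTH GLUING, vertex form, the `NearOneGluing` corollary, and the one-layer class

Lead prover-line-stmt-CriticalPhenomena-4575-c5-0, 2026-08-16.  Companion of
`…NoHeavyLowerTailPocketDepthGluing.lean` (block form `pocketDepthGluing_block`).  Proves the registered stubs

* `pocketDepthGluing` — the observer-vertex case `O = {o}`: if no duplicate-free list of `L + 1` vertices of the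
  free region `F` continues `o` to a positive-weight path, then `(μ(o ↔ A) − μ(o ↔ b)) ^ (L+1) ≤ max_a μ(a ↮ b)`
  and, for `L ≥ 1`, `(μ(o ↔ A) − μ(o ↔ b)) ^ L · μ(o ↮ b) ≤ max_a μ(a ↮ b)`;
* `nearOneGluing_of_pocketDepth` — Kozma–Nitzan's Conjecture 3 ≡ `NearOneGluing` ≡ this crux on the class
  "no positive simple path of `L + 1` free vertices from the observer", with `δ = (ε/2)^(L+1)`, uniformly in
  `|A|`, `n` and the SIZE of the relay-free region;
* `pocketGluing_oneLayer` — the simplest new class beyond Kozma–Nitzan's Theorems 4–5: an observer `o ∉ A`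
  all of whose non-relay neighbours are PRIVATE (adjacent only to `o` and to relays) and mutually
  non-adjacent, in any number: `(μ(o ↔ A) − μ(o ↔ b)) · μ(o ↮ b) ≤ max_a μ(a ↮ b)` and
  `(μ(o ↔ A) − μ(o ↔ b))² ≤ max_a μ(a ↮ b)` (`L = 1`).  KN Thm 5 is the case of ONE such neighbour (with
  the linear rate); lead c4's class `𝒞₁`.

No new definitions.
-/

namespace Summit.CriticalPhenomena.PercolationContinuityZ3.Theorems

open MeasureTheory Set
open Literature.Probability.LatticeModels (prodBernoulli)
open Literature.Probability.Percolation (BondConfig openConn)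

noncomputable section
open Classical

variable {n : ℕ}

/-- **Pocket-depth gluing** (registered stub `pocketDepthGluing` of crux stmt-CriticalPhenomena-4575, line
`bhk-superadditivity-thinning`).  Finite weighted graph on `Fin n`, relay set `A ∋ b`, observer `o ∉ A`, a
vertex set `F ∌ o` disjoint from `A` such that every positive-weight pair with an endpoint in `{o} ∪ F` has
its other endpoint in `{o} ∪ F ∪ A`, and `L` such that no duplicate-free list `l` of `L + 1` vertices of `F`
makes `o :: l` a positive-weight path.  If `μ(a ↮ b) ≤ t` on `A` then
`(μ(o ↔ A) − μ(o ↔ b)) ^ (L + 1) ≤ t`, and for `L ≥ 1` also `(μ(o ↔ A) − μ(o ↔ b)) ^ L · μ(o ↮ b) ≤ t`.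
The case `O = {o}` of `pocketDepthGluing_block` (`glue w {o} = w`). -/
theorem pocketDepthGluing : ∀ (n : ℕ) (w : Sym2 (Fin n) → unitInterval) (F A : Finset (Fin n)) (o b : Fin n) (t : ℝ) (L : ℕ), b ∈ A → o ∉ A → o ∉ F → Disjoint F A → (∀ x ∈ insert o F, ∀ y : Fin n, y ≠ o → y ∉ F → y ∉ A → w s(x, y) = 0) → (∀ l : List (Fin n), l.length = L + 1 → l.Nodup → (∀ x ∈ l, x ∈ F) → ¬ List.IsChain (fun x y : Fin n => w s(x, y) ≠ 0) (o :: l)) → (∀ a ∈ A, (Literature.Probability.LatticeModels.prodBernoulli w).real (Literature.Probability.Percolation.openConn a b)ᶜ ≤ t) → ((Literature.Probability.LatticeModels.prodBernoulli w).real (⋃ a ∈ A, Literature.Probability.Percolation.openConn o a) - (Literature.Probability.LatticeModels.prodBernoulli w).real (Literature.Probability.Percolation.openConn o b)) ^ (L + 1) ≤ t ∧ (1 ≤ L → ((Literature.Probability.LatticeModels.prodBernoulli w).real (⋃ a ∈ A, Literature.Probability.Percolation.openConn o a) - (Literature.Probability.LatticeModels.prodBernoulli w).real (Literature.Probability.Percolation.openConn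 o b)) ^ L * (Literature.Probability.LatticeModels.prodBernoulli w).real (Literature.Probability.Percolation.openConn o b)ᶜ ≤ t) := by
  intro n w F A o b t L hbA hoA hoF hFA hcl hpath hrel
  have hOA : Disjoint ({o} : Finset (Fin n)) A := Finset.disjoint_singleton_left.2 hoA
  have hOF : Disjoint ({o} : Finset (Fin n)) F := Finset.disjoint_singleton_left.2 hoF
  have hcl' : ∀ x ∈ ({o} : Finset (Fin n)) ∪ F, ∀ y : Fin n,
      y ∉ ({o} : Finset (Fin n)) → y ∉ F → y ∉ A → w s(x, y) = 0 := by
    intro x hx y hyo hyF hyA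
    rw [← Finset.insert_eq] at hx
    exact hcl x hx y (fun h => hyo (Finset.mem_singleton.2 h)) hyF hyA
  have hpath' : ∀ o' ∈ ({o} : Finset (Fin n)), ∀ l : List (Fin n), l.length = L + 1 → l.Nodup →
      (∀ x ∈ l, x ∈ F) → ¬ List.IsChain (fun x y : Fin n => w s(x, y) ≠ 0) (o' :: l) := by
    intro o' ho' l hlen hnd hlF
    rw [Finset.mem_singleton.1 ho']
    exact hpath l hlen hnd hlF
  have key := pocketDepthGluing_block n w {o} F A b t L hbA hOA hFA hOF hcl' hpath'
  rw [agPartial_glue_singleton, Finset.set_biUnion_singleton, Finset.set_biUnion_singleton] at key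
  have hset : {ω : BondConfig (Fin n) | ∀ o' ∈ ({o} : Finset (Fin n)), ω ∉ openConn o' b} =
      (openConn o b)ᶜ := by
    ext ω
    simp only [Finset.mem_singleton, forall_eq, Set.mem_setOf_eq, Set.mem_compl_iff]
  rw [hset] at key
  exact key hrel

/-- **`NearOneGluing` (Kozma–Nitzan Conjecture 3 ≡ this crux) on the class "no positive simple path of
`L + 1` free vertices from the observer", with the explicit rate `δ = (ε/2)^(L+1)`** (registered stub
`nearOneGluing_of_pocketDepth` of crux stmt-CriticalPhenomena-4575, line `bhk-superadditivity-thinning`).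
Uniform in `|A|`, in `n` and in the size of the relay-free region; for tree-like pockets `L` is the
height of the tree. -/
theorem nearOneGluing_of_pocketDepth : ∀ (L : ℕ) (ε : ℝ), 0 < ε → ∀ (n : ℕ) (w : Sym2 (Fin n) → unitInterval) (F A : Finset (Fin n)) (o b : Fin n), b ∈ A → o ∉ A → o ∉ F → Disjoint F A → (∀ x ∈ insert o F, ∀ y : Fin n, y ≠ o → y ∉ F → y ∉ A → w s(x, y) = 0) → (∀ l : List (Fin n), l.length = L + 1 → l.Nodup → (∀ x ∈ l, x ∈ F) → ¬ List.IsChain (fun x y : Fin n => w s(x, y) ≠ 0) (o :: l)) → 1 - (ε / 2) ^ (L + 1) < (Literature.Probability.LatticeModels.prodBernoulli w).real (⋃ a ∈ A, Literature.Probability.Percolation.openConn o a) → (∀ a ∈ A, 1 - (ε / 2) ^ (L + 1) < (Literature.Probability.LatticeModels.prodBernoulli w).real (Literature.Probability.Percolation.openConn a b)) → 1 - ε < (Literature.Probability.LatticeModels.prodBernoulli w).real (Literature.Probability.Percolation.openConn o b) := by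
  intro L ε hε n w F A o b hbA hoA hoF hFA hcl hpath hA hrel
  set P := prodBernoulli w with hP
  by_cases hε1 : 1 < ε
  · exact lt_of_lt_of_le (by linarith) measureReal_nonneg
  push Not at hε1
  have hq0 : 0 ≤ ε / 2 := by linarith
  have hq1 : ε / 2 ≤ 1 := by linarith
  obtain ⟨aM, haM, hmax⟩ := Finset.exists_max_image A (fun a => P.real (openConn a b)ᶜ) ⟨b, hbA⟩
  set t₀ : ℝ := P.real (openConn aM b)ᶜ with ht₀
  have ht₀δ : t₀ < (ε / 2) ^ (L + 1) := by
    have h := hrel aM haM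
    rw [ht₀, probReal_compl_eq_one_sub (pocketGlue_measurableSet _)]
    linarith
  obtain ⟨hweak, -⟩ := pocketDepthGluing n w F A o b t₀ L hbA hoA hoF hFA hcl hpath hmax
  set bad : ℝ := P.real (⋃ a ∈ A, openConn o a) - P.real (openConn o b) with hbad
  have hbad_lt : bad < ε / 2 := by
    by_contra hge
    push Not at hge
    have h2 : (ε / 2) ^ (L + 1) ≤ bad ^ (L + 1) := pow_le_pow_left₀ hq0 hge _
    linarith
  have hδε : (ε / 2) ^ (L + 1) ≤ ε / 2 := pow_le_of_le_one hq0 hq1 (Nat.succ_ne_zero L)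
  have : P.real (openConn o b) = P.real (⋃ a ∈ A, openConn o a) - bad := by rw [hbad]; ring
  rw [this]
  linarith

/-- **The one-layer class** (registered stub `pocketGluing_oneLayer` of crux stmt-CriticalPhenomena-4575,
line `bhk-superadditivity-thinning`): an observer `o ∉ A` together with a set `F ∌ o` of PRIVATE non-relay
neighbours — every positive-weight pair at a vertex of `{o} ∪ F` goes into `{o} ∪ F ∪ A`, and no two
vertices of `F` are joined by a positive-weight pair — in any number.  Then
`(μ(o ↔ A) − μ(o ↔ b))² ≤ t` and `(μ(o ↔ A) − μ(o ↔ b)) · μ(o ↮ b) ≤ t` whenever `μ(a ↮ b) ≤ t` on `A`: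
`pocketDepthGluing` with `L = 1` (a positive path `o, x, y` with `x ≠ y` in `F` would use a pair inside
`F`).  Kozma–Nitzan's Theorem 5 (arXiv:2401.12397 p. 13) is `|F| = 1` with the linear rate; for `|F| ≥ 2`
this square-root-rate gluing is the first result. -/
theorem pocketGluing_oneLayer : ∀ (n : ℕ) (w : Sym2 (Fin n) → unitInterval) (F A : Finset (Fin n)) (o b : Fin n) (t : ℝ), b ∈ A → o ∉ A → o ∉ F → Disjoint F A → (∀ x ∈ insert o F, ∀ y : Fin n, y ≠ o → y ∉ F → y ∉ A → w s(x, y) = 0) → (∀ x ∈ F, ∀ y ∈ F, w s(x, y) = 0) → (∀ a ∈ A, (Literature.Probability.LatticeModels.prodBernoulli w).real (Literature.Probability.Percolation.openConn a b)ᶜ ≤ t) → ((Literature.Probability.LatticeModels.prodBernoulli w).real (⋃ a ∈ A, Literature.Probability.Percolation.openConn o a) - (Literature.Probability.LatticeModels.prodBernoulli w).real (Literature.Probability.Percolation.openConn o b)) ^ 2 ≤ t ∧ ((Literature.Probability.LatticeModels.prodBernoulli w).real (⋃ a ∈ A, Literature.Probability.Percolation.openConn o a) - (Literature.Probability.LatticeModels.prodBernoulli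 w).real (Literature.Probability.Percolation.openConn o b)) * (Literature.Probability.LatticeModels.prodBernoulli w).real (Literature.Probability.Percolation.openConn o b)ᶜ ≤ t := by
  intro n w F A o b t hbA hoA hoF hFA hcl hind hrel
  have hpath : ∀ l : List (Fin n), l.length = 1 + 1 → l.Nodup → (∀ x ∈ l, x ∈ F) →
      ¬ List.IsChain (fun x y : Fin n => w s(x, y) ≠ 0) (o :: l) := by
    intro l hlen hnd hlF hch
    match l, hlen with
    | [x, y], _ =>
      rw [List.isChain_cons_cons, List.isChain_pair] at hch
      exact hch.2 (hind x (hlF x (by simp)) y (hlF y (by simp)))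
  obtain ⟨h1, h2⟩ := pocketDepthGluing n w F A o b t 1 hbA hoA hoF hFA hcl hpath hrel
  exact ⟨h1, by simpa only [pow_one] using h2 le_rfl⟩

end

end Summit.CriticalPhenomena.PercolationContinuityZ3.Theorems
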